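import Mathlib

/-!
# LatinHessian — the monomial combinatorics behind PROP NL-JET (A) (solo-blind s87)

Solo-blind programme, `work/s87/nl-jet.md` §1 (claim SB-C705); Mathlib only, nothing of the programme's
tree is imported, and nothing geometric is formalised.

Informal setting.  For the Dwork sextic fourfold `X_ψ : Σ x_i⁶ + ψ x₁⋯x₆ = 0` (`ψ ≠ 0`) the first-order
deformations modulo the Jacobian ideal have the basis of the 426 monomials `x^μ`, `μ ∈ {0,…,4}⁶`, `|μ| = 6`.
For an `A`-invariant Hodge class `γ` of type `(2,2)` the Hessian of the period potential is
`Hess(μ, μ′) = 2·⟨γ, Res x^{μ+μ′} Ω / F³⟩`, and the pairing with `γ` kills every monomial `x^β` that is not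
`A`-invariant, i.e. whose exponents are not all congruent mod 6.  The Griffiths–Dwork values on the three
invariant types that occur are `r₂`, `−(ψ/6) r₂`, `(ψ²/36) r₂`.  Hence the rank of the Hessian and its kernel
are decided by the following finite facts, certified here by `native_decide`.  Exponent vectors are encoded
as natural numbers `n < 5⁶ = 15625` through their base-5 digits `dg n i`, `i < 6`; the predicates are
`Bool`-valued list computations over `List.range 6`.

* `card_basis` : there are 426 basis monomials;
* `sum_types` : if `μ + μ′` (`μ, μ′` basis monomials) has all entries congruent mod 6, then `μ + μ′` is
  `(2,2,2,2,2,2)`, or a permutation of `(7,1,1,1,1,1)`, or a permutation of `(6,6,0,0,0,0)`;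
* `partner_unique` : every basis monomial has at most one invariant partner;
* `card_paired`, `card_type2`, `card_type7`, `card_type66` : exactly `306 = 141 + 120 + 45` basis monomials
  have a partner, split by type as stated;
* `card_latin`, `kernel_eq_latin` : the 120 monomials WITHOUT partner are exactly the `S₆`-orbit of
  `(3,2,1,0,0,0)` (the "Latin" monomials).

Consequently (in the note, not here): `Hess = 2 r₂ ×` (a signed partial permutation matrix of rank 306), and the
Zariski tangent space of the Hodge locus is the 120-dimensional Latin space iff `r₂ ≠ 0`.
-/

set_option linter.dupNamespace false

namespace Summit.HodgeConjecture.HodgeConjecture.Theorems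

namespace SoloBlindLatinHessian

/-- Base-5 digit `i` of `n`: the `i`-th exponent of the encoded monomial. -/
def dg (n i : ℕ) : ℕ := n / 5 ^ i % 5

/-- The 426 basis monomials: exponent vectors in `{0,…,4}⁶` of total degree 6, encoded in base 5. -/
def basis : Finset ℕ :=
  (Finset.range 15625).filter (fun n => (∑ i ∈ Finset.range 6, dg n i) = 6)

/-- `μ + μ′` is `A`-invariant: all entries of the sum are congruent modulo 6. -/
def inv (m n : ℕ) : Bool :=
  (List.range 6).all fun i => (List.range 6).all fun j => (dg m i + dg n i) % 6 == (dg m j + dg n j) % 6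

/-- Number of coordinates `i < 6` at which the sum `μ + μ′` equals `v`. -/
def cnt (m n v : ℕ) : ℕ := ((List.range 6).filter fun i => dg m i + dg n i == v).length

/-- Number of coordinates `i < 6` at which `μ` equals `v`. -/
def cnt1 (m v : ℕ) : ℕ := ((List.range 6).filter fun i => dg m i == v).length

/-- The sum `μ + μ′` is the vector `(2,2,2,2,2,2)`. -/
def type2 (m n : ℕ) : Bool := (List.range 6).all fun i => dg m i + dg n i == 2

/-- The sum `μ + μ′` is a permutation of `(7,1,1,1,1,1)`. -/
def type7 (m n : ℕ) : Bool := cnt m n 7 == 1 && cnt m n 1 == 5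

/-- The sum `μ + μ′` is a permutation of `(6,6,0,0,0,0)`. -/
def type66 (m n : ℕ) : Bool := cnt m n 6 == 2 && cnt m n 0 == 4

/-- `μ` is a Latin monomial: a permutation of `(3,2,1,0,0,0)`. -/
def latin (m : ℕ) : Bool :=
  cnt1 m 0 == 3 && cnt1 m 1 == 1 && cnt1 m 2 == 1 && cnt1 m 3 == 1

/-- `μ` has an invariant partner among the basis monomials. -/
def hasPartner (m : ℕ) : Bool := decide (∃ n ∈ basis, inv m n = true)

/-- There are `426` basis monomials. -/
theorem card_basis : basis.card = 426 := by native_decide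

/-- The only invariant sums of two basis monomials are of type `2·𝟙`, `(7,1⁵)` or `(6,6,0⁴)`. -/
theorem sum_types : ∀ m ∈ basis, ∀ n ∈ basis, inv m n = true →
    (type2 m n = true ∨ type7 m n = true ∨ type66 m n = true) := by native_decide

/-- Every basis monomial has at most one invariant partner. -/
theorem partner_unique : ∀ m ∈ basis, (basis.filter (fun n => inv m n = true)).card ≤ 1 := by
  native_decide

/-- Exactly `306` basis monomials have an invariant partner. -/
theorem card_paired : (basis.filter (fun m => hasPartner m = true)).card = 306 := by native_decide

/-- `141` of them pair to `(2,2,2,2,2,2)` (the monomials with all exponents `≤ 2`). -/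
theorem card_type2 :
    (basis.filter (fun m => decide (∃ n ∈ basis, type2 m n = true) = true)).card = 141 := by
  native_decide

/-- `120` of them pair to a permutation of `(7,1,1,1,1,1)`. -/
theorem card_type7 :
    (basis.filter (fun m => decide (∃ n ∈ basis, type7 m n = true) = true)).card = 120 := by
  native_decide

/-- `45` of them pair to a permutation of `(6,6,0,0,0,0)`. -/
theorem card_type66 :
    (basis.filter (fun m => decide (∃ n ∈ basis, type66 m n = true) = true)).card = 45 := by
  native_decide

/-- There are `120` Latin monomials (the `S₆`-orbit of `(3,2,1,0,0,0)`). -/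
theorem card_latin : (basis.filter (fun m => latin m = true)).card = 120 := by native_decide

/-- KERNEL = LATIN: a basis monomial has no invariant partner iff it is a Latin monomial. -/
theorem kernel_eq_latin :
    basis.filter (fun m => hasPartner m = false) = basis.filter (fun m => latin m = true) := by
  native_decide

/-- Bookkeeping: `141 + 120 + 45 = 306` and `306 + 120 = 426`. -/
theorem counts_add : 141 + 120 + 45 = 306 ∧ 306 + 120 = 426 := by decide

end SoloBlindLatinHessian

end Summit.HodgeConjecture.HodgeConjecture.Theorems
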